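import Summits.Ventures.PercRepro.C041BlockMapClosure
import Summits.Ventures.PercRepro.C041MultiExitCone

/-!
# ROW C-041 — THEOREM (ONE EXIT, BLOCK-MAP FORM): every host with all its exits at one vertex is a cone host —
the base case of THEOREM (SURGERY CLOSURE) (p6, gen 35; THEOREM (PENDANT ZONE) of `C041PendantCone` /
`C041MultiExitCone` for arbitrary cone inputs, not only six-vectors of zones)

Setting of `C041MultiExitCone` (the one-exit block map by the four classes of colourings, `sum_oneExit`; the
coincident-exit sets `merged_const`, `blocks_const`) and `C041BlockMapClosure` (`ConeHost`).  For a host `Z₁`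
and a vertex `v`, the block map with the single exit `v` (index type `Unit`) is
`z·w + x·θ_B w + y·θ_R w + w₀·θ_R(θ_B w)` (`blockMap_oneExit`), and with `x = y` (`xCount_eq_yCount`),
`θ_B w + θ_R w = ℓ(ψ w)` and `θ_R(θ_B w) = n(w)·𝟙` it is `x·ℓ(ψ w) + z·w + w₀·n(w)·𝟙`: a cone member whenever
`w` is, since `ℓ(ψ w)` lies in the cone for every cone member `w` (`inCone_ellv`: the ℓ-decomposition lemma of
`C041TreeClosure` on the 4-vector `K4v w`) and `n(w) ≥ 0` (`nAdm_nonneg`).  Hence **`coneHost_oneExit`: every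
host with one exit is a cone host**, and, the block map at coincident exits being the one-exit block map at the
product of the inputs (`blockMap_const`), **`coneHost_const`: every host with all its exits at one vertex is a
cone host** — the base case from which THEOREM (SURGERY CLOSURE) builds (with THEOREM (UNIT EXIT) for the
exit-free host).
-/

namespace PercRepro

namespace ZoneZ

namespace MultiExit

open ZoneData Pendant Finset TwoExit TreeClosure

/-! ## `ℓ(ψ w)` and `n(w)` on the cone -/

/-- `ℓ(ψ w)` lies in the cone for every cone member `w`. -/
theorem inCone_ellv {w : Vec6} (h : InCone w) : InCone (ellv w) := by
  have := InCone_one.mul_ell (K4v_of_InCone h)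
  rwa [one_mul] at this

/-- The admissible count `n(w) = w₁ + w₂ − w₀` of a cone member is non-negative. -/
theorem nAdm_nonneg {w : Vec6} (h : InCone w) : 0 ≤ nAdm w := by
  have hk := K4v_of_InCone h
  have h1 := hk.t1_nonneg
  have h2 := hk.t2_nonneg
  have h3 := hk.k_nonneg
  have h4 := hk.k_le_g
  unfold nAdm
  linarith

variable {V₁ E₁ U₁ U₂ : Type} (Z₁ : ZoneData V₁ E₁ U₁ U₂) (v a₁ : V₁) [Fintype E₁] [DecidableEq E₁]

/-! ## The one-exit block map -/

omit [Fintype E₁] [DecidableEq E₁] in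
open Classical in
/-- The colouring term of the single exit `v`: the exit vector if `v` is merged, `θ_R` of it otherwise. -/
theorem colTerm_oneExit (ω : E₁ → Bool) (w : Vec6) :
    colTerm Z₁ (fun _ : Unit => v) a₁ ω (fun _ => w) =
      if Z₁.Mg a₁ v ω then exitOf w (Z₁.Rd a₁ v ω) else thR (exitOf w (Z₁.Rd a₁ v ω)) := by
  unfold colTerm
  rw [merged_const, blocks_const]
  split_ifs with h
  · rw [Finset.prod_empty, mul_one, Fintype.prod_unique]
  · rw [Finset.prod_empty, one_mul, Finset.prod_singleton, Fintype.prod_unique]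

/-- **The one-exit block map by the four classes**: `z·w + x·θ_B w + y·θ_R w + w₀·θ_R(θ_B w)`. -/
theorem blockMap_oneExit (w : Vec6) :
    blockMap Z₁ (fun _ : Unit => v) a₁ (fun _ => w) =
      (zCount Z₁ v a₁ : ℝ) • w + (xCount Z₁ v a₁ : ℝ) • thB w + (yCount Z₁ v a₁ : ℝ) • thR w +
        (wCount Z₁ v a₁ : ℝ) • thR (thB w) := by
  rw [blockMap_eq_sum_colTerm, ← sum_oneExit]
  exact Finset.sum_congr rfl fun ω _ => colTerm_oneExit Z₁ v a₁ ω w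

/-- **THEOREM (PENDANT ZONE), block-map form**: the one-exit block map is `x·ℓ(ψ w) + z·w + w₀·n(w)·𝟙`. -/
theorem blockMap_oneExit_ell (w : Vec6) :
    blockMap Z₁ (fun _ : Unit => v) a₁ (fun _ => w) =
      (xCount Z₁ v a₁ : ℝ) • ellv w + (zCount Z₁ v a₁ : ℝ) • w +
        ((wCount Z₁ v a₁ : ℝ) * nAdm w) • (1 : Vec6) := by
  rw [blockMap_oneExit, ← xCount_eq_yCount, thR_thB, smul_smul, add_assoc ((zCount Z₁ v a₁ : ℝ) • w),
    ← smul_add, thB_add_thR]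
  abel

/-- **The one-exit block map sends the cone into the cone.** -/
theorem inCone_blockMap_oneExit {w : Vec6} (h : InCone w) :
    InCone (blockMap Z₁ (fun _ : Unit => v) a₁ (fun _ => w)) := by
  rw [blockMap_oneExit_ell]
  exact (((inCone_ellv h).smul _ (Nat.cast_nonneg _)).add (h.smul _ (Nat.cast_nonneg _))).add
    (InCone_one.smul _ (mul_nonneg (Nat.cast_nonneg _) (nAdm_nonneg h)))

/-- **THEOREM (ONE EXIT)**: every host with one exit is a cone host. -/
theorem coneHost_oneExit : ConeHost Z₁ (fun _ : Unit => v) a₁ := by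
  intro w hw
  have hw' : w = fun _ => w () := by
    funext k
    cases k
    rfl
  rw [hw']
  exact inCone_blockMap_oneExit Z₁ v a₁ (hw ())

/-! ## Coincident exits -/

section Const

variable {ι : Type} [Fintype ι] [Nonempty ι]

omit [Fintype E₁] [DecidableEq E₁] in
open Classical in
/-- The colouring term of exits all at `v`: the one-exit term of the product of the inputs. -/
theorem colTerm_const (ω : E₁ → Bool) (w : ι → Vec6) :
    colTerm Z₁ (fun _ : ι => v) a₁ ω w =
      if Z₁.Mg a₁ v ω then exitOf (∏ k, w k) (Z₁.Rd a₁ v ω) else thR (exitOf (∏ k, w k) (Z₁.Rd a₁ v ω)) := by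
  unfold colTerm
  rw [merged_const, blocks_const, exitOf_prod]
  split_ifs with h
  · rw [Finset.prod_empty, mul_one]
  · rw [Finset.prod_empty, one_mul, Finset.prod_singleton]

/-- **The block map at coincident exits is the one-exit block map at the product of the inputs.** -/
theorem blockMap_const (w : ι → Vec6) :
    blockMap Z₁ (fun _ : ι => v) a₁ w = blockMap Z₁ (fun _ : Unit => v) a₁ (fun _ => ∏ k, w k) := by
  rw [blockMap_eq_sum_colTerm, blockMap_eq_sum_colTerm]
  refine Finset.sum_congr rfl fun ω _ => ?_
  rw [colTerm_const, colTerm_oneExit]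

/-- **THEOREM (COINCIDENT EXITS)**: every host with all its exits at one vertex is a cone host. -/
theorem coneHost_const : ConeHost Z₁ (fun _ : ι => v) a₁ := by
  intro w hw
  rw [blockMap_const]
  exact inCone_blockMap_oneExit Z₁ v a₁ (inCone_prod Finset.univ w fun k _ => hw k)

end Const

end MultiExit

end ZoneZ

end PercRepro
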